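import Literature.Computability.Complexity.MCSPHardnessProofs
import Literature.Computability.Complexity.CSPToCMMSAReduction
import Literature.Computability.MetaComplexity.MCSPStarNPProofs
import Literature.Computability.MetaComplexity.RandReductionsBPPProofs
import HarnessLib

/-!
# P vs NP family: NP-hardness of `MCSP*` — the trust base after the Dinur–Safra step

Bookkeeping file for the named fact `isRandNPHard_MCSPStar` (`MCSPHardness.lean`; Hirahara,
FOCS 2022, Thm. 1.2 = Thm. 8.5 of ECCC TR22-119). With Hirahara's Thm. 5.2 now derived from
Lemma 5.3 (`Hirahara2022_thm52_sqrtLog_of_lem53`, `CSPToCMMSAReduction.lean`), the fact follows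
from exactly three named facts:

1. `Hirahara2022_lem53_logPow_queried` (`GapCSPQueried.lean`) — the sliding-scale PCP of
   Dinur–Fischer–Kindler–Raz–Safra / Dinur–Harsha–Kindler in compact MaxCSP form (Lemma 5.3);
2. `dinurSafraMap_mem_FP` (`CSPToCMMSAReduction.lean`) — polynomial-time computability of the
   (patched) instance map of the proof of Thm. 5.2 on codes (routine implementation fact);
3. `Hirahara2022_gapCMMSA_randReducible_MCSPStar` (`MCSPHardnessProofs.lean`) — Lemma 8.3 with
   the `MCSP*` case of the proof of Thm. 8.5 (secret sharing, Nisan–Wigderson designs, the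
   Impagliazzo–Wigderson derandomized XOR lemma, Uhlig's theorem, Kolmogorov-complexity
   information extraction).

Everything else on the route `NP --Karp--> gapCSP --Karp--> gapCMMSA --randomized--> MCSP*`
is proved in the tree (`GapCSP.lean`, `GapCSPQueried.lean`, `CSPToCMMSA*.lean`, `CMMSA.lean`,
`PromiseRandReductions.lean`, `MCSPHardnessProofs.lean`).

## References

* S. Hirahara, *NP-hardness of learning programs and partial MCSP*, FOCS 2022; ECCC TR22-119:
  Thm. 1.2, Thm. 5.2, Lemma 5.3, Lemma 8.3, Thm. 8.5.
-/

namespace Literature.Computability.Complexity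

/-- **`MCSP*` is NP-hard under randomized reductions, from the three remaining named facts**
(the PCP of Lemma 5.3 in compact MaxCSP form, the polynomial-time computability of the
Dinur–Safra map, and Lemma 8.3 / Thm. 8.5 for `MCSP*`): Thm. 5.2 is obtained from the first two
by `Hirahara2022_thm52_sqrtLog_of_lem53` and combined with the third by
`isRandNPHard_MCSPStar_of_CMMSA`. [cite: Hirahara2022PartialMCSP, proof of Thm. 8.5 (p. 30) with Thm. 5.2 and Lemma 5.3] -/
theorem isRandNPHard_MCSPStar_of_lem53 (h53 : Hirahara2022_lem53_logPow_queried)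
    (hFP : dinurSafraMap_mem_FP) (h83 : Hirahara2022_gapCMMSA_randReducible_MCSPStar) :
    isRandNPHard_MCSPStar :=
  isRandNPHard_MCSPStar_of_CMMSA (Hirahara2022_thm52_sqrtLog_of_lem53 h53 hFP) h83

/-- The randomized NP-*completeness* of `MCSP*` (`IsRandComplete NP MCSPStar`) from the same
three facts and `MCSP* ∈ NP` (`MCSPStar_mem_NP`). [cite: Hirahara2022PartialMCSP, Thm. 8.5 and §1.2] -/
theorem isRandComplete_NP_MCSPStar_of_lem53 (hNP : MetaComplexity.MCSPStar_mem_NP)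
    (h53 : Hirahara2022_lem53_logPow_queried) (hFP : dinurSafraMap_mem_FP)
    (h83 : Hirahara2022_gapCMMSA_randReducible_MCSPStar) :
    MetaComplexity.IsRandComplete Nondeterministic.NP MetaComplexity.MCSPStar :=
  isRandComplete_NP_MCSPStar_of_CMMSA hNP (Hirahara2022_thm52_sqrtLog_of_lem53 h53 hFP) h83

/-! ### Randomized NP-completeness of `MCSP*`: reduction to the hardness fact

With `MCSP* ∈ NP` discharged (`MetaComplexity.MCSPStar_mem_NP_holds`,
`MetaComplexity/MCSPStarNPProofs.lean`), the randomized NP-completeness of `MCSP*`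
(`IsRandComplete NP MCSPStar`, i.e. `MCSPStar ∈ NP ∧ IsRandHard NP MCSPStar`) carries exactly the
content of the hardness fact `isRandNPHard_MCSPStar` (Hirahara 2022, Thm. 1.2 = Thm. 8.5 of
ECCC TR22-119): `isRandComplete_NP_MCSPStar_iff`. It is therefore NOT a separate named fact (the
interim fact `isRandComplete_NP_MCSPStar` of `MCSPHardness.lean`, a corollary demoted to a fact by
the M5 import, is merged into `isRandNPHard_MCSPStar` under D-0026): the completeness statement is
`isRandComplete_NP_MCSPStar_of_isRandNPHard` applied to a discharge of `isRandNPHard_MCSPStar`,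
i.e. (`isRandNPHard_MCSPStar_of_lem53`) of the three named facts listed in the module
docstring: `isRandComplete_NP_MCSPStar_of_lem53'`. -/

/-- **`MCSP*` is randomly NP-complete iff it is randomly NP-hard**, membership `MCSP* ∈ NP`
being proved (`MetaComplexity.MCSPStar_mem_NP_holds`: guess a consistent circuit and check it
on the defined entries; Hirahara 2022, §1.2 and Def. 8.4). The right-hand side is the named
fact `isRandNPHard_MCSPStar` (Hirahara 2022, Thm. 1.2). [cite: Hirahara2022PartialMCSP, Thm. 1.2 and §1.2 ("MCSP* ∈ NP")] -/
theorem isRandComplete_NP_MCSPStar_iff :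
    MetaComplexity.IsRandComplete Nondeterministic.NP MetaComplexity.MCSPStar ↔
      isRandNPHard_MCSPStar :=
  ⟨fun h => MetaComplexity.IsRandComplete.isRandHard h,
    fun h => ⟨MetaComplexity.MCSPStar_mem_NP_holds, h⟩⟩

/-- The randomized NP-completeness of `MCSP*` from its randomized NP-hardness alone
(`MCSP* ∈ NP` is `MetaComplexity.MCSPStar_mem_NP_holds`). [cite: Hirahara2022PartialMCSP, Thm. 1.2 and §1.2] -/
theorem isRandComplete_NP_MCSPStar_of_isRandNPHard (h : isRandNPHard_MCSPStar) :
    MetaComplexity.IsRandComplete Nondeterministic.NP MetaComplexity.MCSPStar :=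
  isRandComplete_NP_MCSPStar_iff.mpr h

/-- The randomized NP-completeness of `MCSP*` from the three remaining named facts alone (the
PCP of Lemma 5.3 in compact MaxCSP form, the polynomial-time computability of the Dinur–Safra
map, and Lemma 8.3 / Thm. 8.5 for `MCSP*`), `MCSP* ∈ NP` being supplied by
`MetaComplexity.MCSPStar_mem_NP_holds` (cf. `isRandComplete_NP_MCSPStar_of_lem53`, which takes it
as a fourth hypothesis). [cite: Hirahara2022PartialMCSP, Thm. 8.5 with Thm. 5.2, Lemma 5.3 and §1.2] -/
theorem isRandComplete_NP_MCSPStar_of_lem53' (h53 : Hirahara2022_lem53_logPow_queried)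
    (hFP : dinurSafraMap_mem_FP) (h83 : Hirahara2022_gapCMMSA_randReducible_MCSPStar) :
    MetaComplexity.IsRandComplete Nondeterministic.NP MetaComplexity.MCSPStar :=
  isRandComplete_NP_MCSPStar_of_isRandNPHard (isRandNPHard_MCSPStar_of_lem53 h53 hFP h83)

/-! ### `MCSP* ∈ BPP ⇒ NP ⊆ BPP`: reduction to the hardness facts

The named fact `NP_subset_BPP_of_MCSPStar_mem_BPP` (`MCSPHardness.lean`; the standard corollary of
Hirahara 2022, Thm. 1.2 — "MCSP* … are NP-hard under randomized polynomial-time reductions",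
ECCC TR22-119 p. 5, whose size parameter is "inevitable unless NP can be solved in randomized
sub-exponential time", p. 6 — by Arora–Barak's remark after Def. 7.16, p. 138: "if `C ∈ BPP`
and `B ≤ᵣ C`, then `B ∈ BPP`"). Its interim proof went through the closure fact
`mem_BPP_of_polyTimeRandReducible`, which is refuted as vendored
(`MetaComplexity.not_mem_BPP_of_polyTimeRandReducible`, `RandReductionsLeak.lean`: G14's
`PolyTimeRandReducible` leaks the coin length), so `isRandNPHard_MCSPStar` — stated with that weak
reducibility — does not yield it. The faithful route is the one the vendored reduction facts
already take: Hirahara's reduction is a `PromiseRandReducible` one (exact polynomial coin budget,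
`PromiseRandReductions.lean`) from the Karp-NP-hard gap problem CMMSA, and `BPP` is closed
downward under such reductions (`MetaComplexity.subset_BPP_of_isHard_promise_of_mem_BPP`,
`RandReductionsBPPProofs.lean`, proved). Hence the fact follows from the SAME named facts as
`isRandNPHard_MCSPStar` (`NP_subset_BPP_of_MCSPStar_mem_BPP_of_CMMSA`, `…_of_lem53`), with all
glue proved; its discharge `NP_subset_BPP_of_MCSPStar_mem_BPP_holds` waits on exactly those. -/

/-- **`MCSP* ∈ BPP ⇒ NP ⊆ BPP` from any randomized reduction of an NP-hard promise problem to
`MCSP*`.** If some promise problem `Q` that is NP-hard under Karp reductions reduces to `MCSP*` by a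
randomized polynomial-time many-one reduction in Arora–Barak's normal form
(`PromiseRandReducible Q (ofLanguage MCSPStar)`), then `MCSP* ∈ BPP` implies `NP ⊆ BPP`
(`MetaComplexity.subset_BPP_of_isHard_promise_of_mem_BPP`: compose each Karp reduction into `Q`
with the randomized one and use the downward closure of `BPP`). [cite: AroraBarakCC2009, §7.6 (Def. 7.16 and the following remark)] -/
theorem NP_subset_BPP_of_MCSPStar_mem_BPP_of_promiseRandReducible {Q : PromiseProblem}
    (hQ : Q.IsNPHard)
    (h : MetaComplexity.PromiseRandReducible Q
      (PromiseProblem.ofLanguage MetaComplexity.MCSPStar)) :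
    NP_subset_BPP_of_MCSPStar_mem_BPP :=
  fun hBPP => MetaComplexity.subset_BPP_of_isHard_promise_of_mem_BPP hQ h hBPP

/-- **`MCSP* ∈ BPP ⇒ NP ⊆ BPP` from Hirahara's Thm. 5.2 and Lemma 8.3 / Thm. 8.5.** NP-hardness
of CMMSA at `Δ(n) = (log n)^{1/2}` (fact `Hirahara2022_thm52_sqrtLog`) and the randomized reduction
from that gap problem to `MCSP*` (fact `Hirahara2022_gapCMMSA_randReducible_MCSPStar`) — the two
facts from which `isRandNPHard_MCSPStar_of_CMMSA` assembles Thm. 1.2 — give the corollary, by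
`NP_subset_BPP_of_MCSPStar_mem_BPP_of_promiseRandReducible`. [cite: Hirahara2022PartialMCSP, Thm. 1.2 (p. 5) and proof of Thm. 8.5 (p. 30)] -/
theorem NP_subset_BPP_of_MCSPStar_mem_BPP_of_CMMSA
    (h52 : MetaComplexity.Hirahara2022_thm52_sqrtLog)
    (h83 : Hirahara2022_gapCMMSA_randReducible_MCSPStar) :
    NP_subset_BPP_of_MCSPStar_mem_BPP := by
  obtain ⟨α, hα, hhard⟩ := h52
  exact NP_subset_BPP_of_MCSPStar_mem_BPP_of_promiseRandReducible hhard (h83 α hα)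

/-- **`MCSP* ∈ BPP ⇒ NP ⊆ BPP` from the three remaining named facts** of the trust base of
`isRandNPHard_MCSPStar` (module docstring): the sliding-scale PCP of Lemma 5.3 in compact MaxCSP
form, the polynomial-time computability of the Dinur–Safra map, and Lemma 8.3 / Thm. 8.5 for
`MCSP*` (Thm. 5.2 via `Hirahara2022_thm52_sqrtLog_of_lem53`). [cite: Hirahara2022PartialMCSP, Thm. 1.2 with Thm. 5.2, Lemma 5.3 and Thm. 8.5] -/
theorem NP_subset_BPP_of_MCSPStar_mem_BPP_of_lem53 (h53 : Hirahara2022_lem53_logPow_queried)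
    (hFP : dinurSafraMap_mem_FP) (h83 : Hirahara2022_gapCMMSA_randReducible_MCSPStar) :
    NP_subset_BPP_of_MCSPStar_mem_BPP :=
  NP_subset_BPP_of_MCSPStar_mem_BPP_of_CMMSA (Hirahara2022_thm52_sqrtLog_of_lem53 h53 hFP) h83

end Literature.Computability.Complexity
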